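import Summits.AtomisticToContinuum.FouriersLaw.Theses.KineticCorner
import Summits.AtomisticToContinuum.FouriersLaw.Theorems.EmbeddedDrudeMourreDrudeDissolutionStubAbsCurrentCorrelationLe
import Summits.AtomisticToContinuum.FouriersLaw.Theorems.EmbeddedDrudeMourreDrudeDissolutionStubCurrentVarianceOfBondForce
import Summits.AtomisticToContinuum.FouriersLaw.Theorems.EmbeddedDrudeMourreDrudeDissolutionStubBondForceVarianceOfIdentity
import Summits.AtomisticToContinuum.FouriersLaw.Theorems.EmbeddedDrudeMourreDrudeDissolutionStubBondForceIdentity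
import Literature.MathematicalPhysics.KineticTheory.InfiniteChainAmplitudeScaling
import HarnessLib

/-!
# `KineticCorner.StationaryCorrelationBound` (stmt-AtomisticToContinuum-3435): the a priori bound `|C_T(t)| ≤ B·T²`

Support item `StationaryCorrelationBound` of route `KineticCorner` (sub-problem `FouriersLaw`): for `pinnedChain ω₂ lam β γ`
(all `> 0`) there are `B` and `T₁ > 0` such that every GOOD triple `(T, μ, D)` — `μ` a DLR state at `T`, `D` a `μ`-preserving
infinite-volume dynamics with absolutely convergent and locally integrable summed current correlations, `μ` invariant under the
unit shift, flow shift-covariant — with `0 < T < T₁` satisfies `|C_T(t)| ≤ B·T²` for all `t ≥ 0` (`C_T = D.currentCorrelation μ`).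

PROVED here by composing the four stubs of line `Sketch` of the crux `DrudeDissolution` (stmt-12593, lead c5), all landed under
`Summit.AtomisticToContinuum.FouriersLaw.Theorems.DrudeDissolution.LineSketch`:
* CA `stub_absCurrentCorrelation_le` — `|C_T(t)| ≤ C_T(0)` (stationarity; Fejér representation of `C_T`, tree
  `currentCorrelation_positiveType`);
* CVG `stub_currentVariance_of_bondForce` — `C_T(0) ≤ T·∫V'(r₀)² dμ` (conditional Gaussian momenta);
* CVS-I `stub_bondForceIdentity` — the DLR integration-by-parts (Schwinger–Dyson) identity for the bond force with its moments;
* CVS-M `stub_bondForceVariance_of_identity` — the moment algebra `∫V'(r₀)² dμ_T ≤ B·T` for `T < T₁ = ω₂/(12β)`.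
This closes stmt-3435 and is the third hypothesis of the landed glue `TargetGlue` (stmt-3436): with `GoodFamilyExists` (stmt-3434)
proved, the kinetic-corner target `KineticCornerGreenKubo` — hence `DrudeDissolution` and `MourreDissolution` — is reduced to the
route's two cruxes `PostKineticTail` (stmt-3430) and `KineticLimit` (stmt-3431) exactly.
-/

noncomputable section

open MeasureTheory

namespace Summit.AtomisticToContinuum.FouriersLaw.Theorems.KineticCorner

open Literature.MathematicalPhysics.KineticTheory.HeatConduction
open Summit.AtomisticToContinuum.FouriersLaw.Theorems.DrudeDissolution.LineSketch

/-- **The static bond-force variance is `O(T)`**: for `pinnedChain ω₂ lam β γ` (all `> 0`) there are `B`, `T₁ > 0` with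
`V'(q₁ − q₀)² ∈ L¹(μ)` and `∫ V'(q₁ − q₀)² dμ ≤ B·T` for every `T ∈ (0, T₁)` and every DLR state `μ` at `T` invariant under the
unit shift (CVS-I + CVS-M; `deriv V r = r + βr³`). [folklore] -/
theorem bondForceVariance_le (ω₂ lam β γ : ℝ) (hω : 0 < ω₂) (hl : 0 < lam) (hβ : 0 < β) (hγ : 0 < γ) :
    ∃ B T₁ : ℝ, 0 < T₁ ∧ ∀ (T : ℝ) (μ : Measure ChainConfig), 0 < T → T < T₁ →
      (pinnedChain ω₂ lam β γ).IsChainGibbsMeasure T μ →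
      MeasurePreserving (fun σ : ChainConfig => fun i : ℤ => σ (i + 1)) μ μ →
      Integrable (fun σ : ChainConfig => deriv (pinnedChain ω₂ lam β γ).V ((σ 1).1 - (σ 0).1) ^ 2) μ ∧
        ∫ σ, deriv (pinnedChain ω₂ lam β γ).V ((σ 1).1 - (σ 0).1) ^ 2 ∂μ ≤ B * T := by
  obtain ⟨B, T₁, hT₁, hM⟩ := stub_bondForceVariance_of_identity ω₂ lam β hω hl hβ
  refine ⟨B, T₁, hT₁, fun T μ hT hTlt hG hshift => ?_⟩
  haveI : IsProbabilityMeasure μ := hG.isProbabilityMeasure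
  obtain ⟨hk, hA, hB2, hC2, hAB, hAC, hAD, hBB, hCC, hI⟩ :=
    stub_bondForceIdentity ω₂ lam β γ hω hl hβ hγ T μ hT hG hshift
  have hV : deriv (pinnedChain ω₂ lam β γ).V = fun r => r + β * r ^ 3 :=
    funext fun r => (AmplitudeScaling.hasDerivAt_V ω₂ lam β γ r).deriv
  simp only [hV]
  exact ⟨hA, hM T μ hT hTlt inferInstance hk hA hB2 hC2 hAB hAC hAD hBB hCC hI⟩

/-- **The static current variance is `O(T²)`**: `C_T(0) ≤ B·T²` for `T < T₁`, every DLR state at `T` invariant under the unit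
shift and every preserving dynamics (CVG + `bondForceVariance_le`). [folklore] -/
theorem currentVariance_le (ω₂ lam β γ : ℝ) (hω : 0 < ω₂) (hl : 0 < lam) (hβ : 0 < β) (hγ : 0 < γ) :
    ∃ B T₁ : ℝ, 0 < T₁ ∧ ∀ (T : ℝ) (μ : Measure ChainConfig) (D : InfiniteChainDynamics (pinnedChain ω₂ lam β γ)),
      0 < T → T < T₁ →
      (pinnedChain ω₂ lam β γ).IsChainGibbsMeasure T μ →
      MeasurePreserving (fun σ : ChainConfig => fun i : ℤ => σ (i + 1)) μ μ →
      D.PreservesMeasure μ →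
      D.currentCorrelation μ 0 ≤ B * T ^ 2 := by
  obtain ⟨B, T₁, hT₁, hB⟩ := bondForceVariance_le ω₂ lam β γ hω hl hβ hγ
  refine ⟨B, T₁, hT₁, fun T μ D hT hTlt hG hshift hP => ?_⟩
  obtain ⟨-, hle⟩ := hB T μ hT hTlt hG hshift
  calc D.currentCorrelation μ 0
      ≤ T * ∫ σ, deriv (pinnedChain ω₂ lam β γ).V ((σ 1).1 - (σ 0).1) ^ 2 ∂μ :=
        stub_currentVariance_of_bondForce ω₂ lam β γ hω hl hβ hγ T μ D hT hG hshift hP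
    _ ≤ T * (B * T) := mul_le_mul_of_nonneg_left hle hT.le
    _ = B * T ^ 2 := by ring

/-- **`StationaryCorrelationBound` holds** (`Theses.KineticCorner.StationaryCorrelationBound`, stmt-AtomisticToContinuum-3435):
for `pinnedChain ω₂ lam β γ` (all `> 0`) there are `B`, `T₁ > 0` such that every good triple `(T, μ, D)` with `0 < T < T₁` has
`|C_T(t)| ≤ B·T²` for all `t ≥ 0` — stationarity `|C_T(t)| ≤ C_T(0)` (CA) and the static variance bound `C_T(0) ≤ B·T²`.
[folklore] -/
theorem stationaryCorrelationBound_proof :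
    Summit.AtomisticToContinuum.FouriersLaw.Theses.KineticCorner.StationaryCorrelationBound := by
  intro ω₂ lam β γ hω hl hβ hγ
  obtain ⟨B, T₁, hT₁, hB⟩ := currentVariance_le ω₂ lam β γ hω hl hβ hγ
  refine ⟨B, T₁, hT₁, fun T μ D hT hTlt hgood t _ => ?_⟩
  obtain ⟨hG, hP, hA, -, hshift, hcov⟩ := hgood
  exact (stub_absCurrentCorrelation_le ω₂ lam β γ hω hl hβ hγ T μ D hT hG hP hA hshift hcov t).trans
    (hB T μ D hT hTlt hG hshift hP)

end Summit.AtomisticToContinuum.FouriersLaw.Theorems.KineticCorner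

end
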